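import Literature.Probability.RandomPlanarGeometry.SLEKappaRhoLogGamma
import Literature.Probability.RandomPlanarGeometry.SLEKappaRhoTranslates
import HarnessLib

/-!
# Every `+`-hull admits a jet control on a thin box along `[−R−3, 0]`

G. F. Lawler, O. Schramm, W. Werner, *Conformal restriction: the chordal case*, J. Amer. Math.
Soc. **16** (2003) 917–955 (**[LSW]**), §8.4, proof of Lemma 8.9: the Itô expansion of
`log M_t` is a computation with the jets of `E = E_{B_t}` (the reflected extension of `Φ_{B_t}`,
`B_t = A_t − W_t ∈ 𝒬₊`) at the two real points `0` and `O_t − W_t ≤ 0`. The deterministic part of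
our formalisation (`SLEKappaRhoLogGamma` … `SLEKappaRhoOneStepBounds`) is carried out under the
quantitative hypothesis bundle `SLEKappaRho.JetControl E δ η R` (holomorphy of `E` on the box
`jetBox R η = (−R−3, 2η) × (−2η, 2η)`, `|E'| ≤ 2` and `Re E' ≥ δ` there, `E(0) = 0`, `E` real on
the real points of the box).

This file proves the QUALITATIVE EXISTENCE of such a control for every `+`-hull and every
`R ≥ 0` (`IsPlusHull.exists_jetControl`): `E_B` is holomorphic on the open symmetric domain
`ℂ ∖ (B ∪ B̄)` containing the compact real segment `K = [−R−3, x₁]` (`x₁ > 0` small), on which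
`E_B'` is real with `0 < E_B' ≤ 1` (`re_deriv_starMap_pos_le_one`); by continuity and compactness
a closed thickening of `K` still lies in the domain with `|E'| < 2` and `Re E' > m/2` (`m > 0` the
minimum of `E'` on `K`), and a thin enough box lies in that thickening.

It is used to identify the jets of `log M_t` with their closed forms at every sample point (so
that the jet processes are measurable) in the proof of [LSW] Lemma 8.9 for SLE(8/3, ρ).

No named facts.
-/

noncomputable section

open Set Filter Metric Complex
open scoped Topology

namespace Literature.Probability.RandomPlanarGeometry

namespace IsPlusHull

variable {B : Set ℂ}

/-- A `*`-hull misses a small real interval `[0, x₁]` to the right of the origin. [folklore] -/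
theorem exists_pos_forall_ofReal_notMem (hB : IsStarHull B) :
    ∃ x₁ : ℝ, 0 < x₁ ∧ ∀ x : ℝ, |x| ≤ x₁ → (x : ℂ) ∉ B := by
  have hopen : IsOpen (Bᶜ : Set ℂ) := hB.1.isCompact.isClosed.isOpen_compl
  obtain ⟨r, hr, hball⟩ := Metric.isOpen_iff.1 hopen 0 hB.2
  refine ⟨r / 2, by positivity, fun x hx hxB ↦ ?_⟩
  have : (x : ℂ) ∈ ball (0 : ℂ) r := by
    rw [mem_ball, dist_zero_right, norm_real, Real.norm_eq_abs]; linarith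
  exact hball this hxB

/-- **Every `+`-hull admits a jet control along `[−R−3, 0]`**: for `B ∈ 𝒬₊` and `R ≥ 0` there are
`δ, η > 0` with `SLEKappaRho.JetControl (starMap B) δ η R`.
[cite: LawlerSchrammWerner2003Restriction, §8.4 proof of Lemma 8.9 (the jets of h_t at W_t and O_t)] -/
theorem exists_jetControl (hB : IsPlusHull B) {R : ℝ} (hR : 0 ≤ R) :
    ∃ δ η : ℝ, SLEKappaRho.JetControl (starMap B) δ η R := by
  have hst := hB.1
  obtain ⟨x₁, hx₁, hx₁B⟩ := exists_pos_forall_ofReal_notMem hst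
  -- real points of `K = [−R−3, x₁]` are off the hull
  have hoff : ∀ x : ℝ, x ∈ Icc (-R - 3) x₁ → (x : ℂ) ∉ B := by
    intro x hx
    rcases le_or_gt x 0 with h0 | h0
    · exact hB.ofReal_notMem_of_nonpos h0
    · exact hx₁B x (by rw [abs_of_pos h0]; exact hx.2)
  -- holomorphy of `E` and continuity of `E'` on the open symmetric domain
  have hΦ := isRestrictionMap_starRMap hst
  have hE : DifferentiableOn ℂ (starMap B) (symmDomain B) := by
    rw [starMap_eq hst]; exact differentiableOn_hullExt hst.isBoundedHull hΦ
  have hopen : IsOpen (symmDomain B) := isOpen_symmDomain hst.isBoundedHull.isClosed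
  have hcd : ContinuousOn (deriv (starMap B)) (symmDomain B) := ((hE.analyticOnNhd hopen).deriv).continuousOn
  -- the compact segment and the minimum `m > 0` of `E'` on it
  set K : Set ℂ := (fun x : ℝ ↦ (x : ℂ)) '' Icc (-R - 3) x₁ with hK
  have hKc : IsCompact K := isCompact_Icc.image continuous_ofReal
  have hKsub : K ⊆ symmDomain B := by
    rintro _ ⟨x, hx, rfl⟩; exact ofReal_mem_symmDomain_iff.2 (hoff x hx)
  have hKne : K.Nonempty := ⟨((0 : ℝ) : ℂ), 0, ⟨by linarith, hx₁.le⟩, rfl⟩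
  obtain ⟨z₀, hz₀K, hz₀min⟩ := hKc.exists_isMinOn hKne ((continuous_re.comp_continuousOn hcd).mono hKsub)
  set m : ℝ := (deriv (starMap B) z₀).re with hm
  have hm0 : 0 < m := by
    obtain ⟨x, hx, rfl⟩ := hz₀K
    exact (re_deriv_starMap_pos_le_one hst (hoff x hx)).1
  have hmK : ∀ z ∈ K, m ≤ (deriv (starMap B) z).re := fun z hz ↦ hz₀min hz
  -- the open set `U` and a closed thickening of `K` inside it
  set U : Set ℂ := symmDomain B ∩ ((deriv (starMap B)) ⁻¹' ({w : ℂ | ‖w‖ < 2} ∩ {w : ℂ | m / 2 < w.re})) with hU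
  have hUo : IsOpen U := by
    refine hcd.isOpen_inter_preimage hopen ?_
    exact (isOpen_lt continuous_norm continuous_const).inter (isOpen_lt continuous_const continuous_re)
  have hKU : K ⊆ U := by
    intro z hz
    refine ⟨hKsub hz, ?_, ?_⟩
    · obtain ⟨x, hx, rfl⟩ := hz
      have h := re_deriv_starMap_pos_le_one hst (hoff x hx)
      show ‖deriv (starMap B) x‖ < 2
      rw [deriv_starMap_ofReal_eq_re hst (hoff x hx), norm_real, Real.norm_eq_abs, abs_of_pos h.1]
      linarith [h.2]
    · show m / 2 < (deriv (starMap B) z).re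
      linarith [hmK z hz]
  obtain ⟨ε, hε, hthick⟩ := hKc.exists_cthickening_subset_open hUo hKU
  -- the box parameters
  set η : ℝ := min (ε / 4) (min (x₁ / 2) 1) with hη
  have hη0 : 0 < η := lt_min (by positivity) (lt_min (by positivity) one_pos)
  have hηε : η ≤ ε / 4 := min_le_left _ _
  have hηx : η ≤ x₁ / 2 := (min_le_right _ _).trans (min_le_left _ _)
  have hη1 : η ≤ 1 := (min_le_right _ _).trans (min_le_right _ _)
  -- the box lies in the thickening
  have hbox : SLEKappaRho.jetBox R η ⊆ U := by
    intro z hz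
    obtain ⟨⟨hz1, hz2⟩, hz3⟩ := hz
    refine hthick ?_
    rw [mem_cthickening_iff]
    -- the point `(re z) ∈ K` is at distance `|im z| < 2η ≤ ε/2`
    have hreK : ((z.re : ℝ) : ℂ) ∈ K := ⟨z.re, ⟨hz1.le, by linarith⟩, rfl⟩
    calc Metric.infEDist z K ≤ edist z ((z.re : ℝ) : ℂ) := Metric.infEDist_le_edist_of_mem hreK
      _ ≤ ENNReal.ofReal ε := by
          rw [edist_dist, dist_eq_norm]
          refine ENNReal.ofReal_le_ofReal ?_
          have : z - (z.re : ℂ) = (z.im : ℂ) * I := by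
            apply Complex.ext <;> simp
          rw [this, norm_mul, norm_I, mul_one, norm_real, Real.norm_eq_abs]
          linarith
  refine ⟨m / 2, η, ?_⟩
  exact
    { δ_pos := by positivity
      η_pos := hη0
      η_le_one := hη1
      R_nonneg := hR
      differentiableOn := hE.mono fun z hz ↦ (hbox hz).1
      norm_deriv_le := fun z hz ↦ le_of_lt (hbox hz).2.1
      le_re_deriv := fun z hz ↦ le_of_lt (hbox hz).2.2
      map_zero := starMap_zero hst
      im_ofReal := fun x hx ↦ by
        have hxoff : (x : ℂ) ∉ B := by
          rcases le_or_gt x 0 with h0 | h0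
          · exact hB.ofReal_notMem_of_nonpos h0
          · refine hx₁B x ?_
            rw [abs_of_pos h0]
            have := hx.1.2; simp only [ofReal_re] at this; linarith
        rw [starMap_ofReal_eq_re' hst hxoff]; simp }

end IsPlusHull

end Literature.Probability.RandomPlanarGeometry

end
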